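import Literature.MathematicalPhysics.QuantumFieldTheory.Balaban1983to89.B16Eq190Resummation
import Literature.MathematicalPhysics.QuantumFieldTheory.Balaban1983to89.T4DilationKPLog

/-!
# `Balaban1983to89.B16CurlyBracketVolume` — [Balaban1989LargeFieldII] pp. 387–390 with [Balaban1988Convergent] (2.46)∕(2.49)
# p. 263–264: the VOLUME BOUND of the exponentiated curly bracket of (1.72) — `|Σ_X 𝐑′^{(k)}(X)| ≤ O(1)·(number of M-cubes
# outside ⋃_i Y_i)`, hence `e^{−O(1)·#cubes} ≤ |{⋯}| ≤ e^{O(1)·#cubes}`, and for REAL data `{⋯} > 0`, `{⋯} = e^{ρ}` with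
# `|ρ| ≤ O(1)·#cubes` — the SUPPLIER of the hypotheses `hcurly`, `h0c`∕`hR` of `B16Cor3Ops.Repr172.uvIneq_of_repr172`
# (Corollary 3 ∕ (2.50) [III], one run, one step)

CITATION HEADER (lean-in-tree rule 2026-08-18).  Sources: T. Bałaban, *Large field renormalization. II. Localization,
exponentiation, and bounds for the 𝐑 operation*, Commun. Math. Phys. **122**, 355–392 (1989), doi:10.1007/bf01238433
[Balaban1989LargeFieldII] (cell paper B16 = [V]; held: `paper:balaban1989-cmp122-large-field-ii`; journal page = PDF page + 354)
and T. Bałaban, *Convergent renormalization expansions for lattice gauge theories*, Commun. Math. Phys. **119**, 243–285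
(1988) [Balaban1988Convergent] ([III]); the Kotecký–Preiss engine is R. Kotecký, D. Preiss, Commun. Math. Phys. **103**
(1986) 491–498 [KoteckyPreiss1986], PROVED in the tree (`Literature.Probability.LatticeModels.ClusterExpansion*`).
WHAT IS PRINTED.  [V] p. 390 [36]: *"The estimate (1.97) is sufficient for convergence of the exponentiated cluster expansion,
and we have {⋯} = exp 𝐑′^{(k)} = exp Σ_X 𝐑′^{(k)}(X). (1.98) … |𝐑′^{(k)}(X,(𝐔,𝐉))| ≤ O(1)c₁ exp(−(1+½β)κ d_{k,∪Y_i}(X)).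
(1.99) … From (1.72), (1.98), and the above definitions, it follows that the result 𝐑ρ_k of the 𝐑-operation can be written in
the form (2.18) [III]"*; [V] p. 387 [33]: *"This implies the inequality (2.50) [III], hence Corollary 3."*; [III] p. 263 [21],
(2.46): *"|𝐑_k(U_k)| ≤ R₁ Σ_{n=1}^{k} |Γ_n| Σ_{j=1}^{n} g_j^{κ₀} < … < Σ_{n=1}^{k} |Γ_n|"*; [III] p. 264 [22], (2.49):
*"A_k(1/g_k², U_k) = −A(1/g_k², U_k) + (the logarithmic terms) + O(1) Σ_{j=1}^{k} |Γ_j|. (2.49) … Thus we estimate the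
integral ∫dV_kρ_k by a sum of terms similar to the one considered in Sect. 3 [6]"*, leading to (2.50): *"χ_k exp[−(1/g_k²)
A(U_k(V_k)) − E₋|T_η|] ≦ ρ_k(V_k) ≦ exp E₊|T_η|"*.  The step typed here is the VOLUME SUMMATION that turns the per-domain
activity bound (1.97)∕(1.99) into a bound LINEAR IN THE NUMBER OF CUBES for the whole exponent `Σ_X 𝐑′^{(k)}(X)` of the curly
bracket — the «O(1) Σ_j |Γ_j|» bookkeeping of (2.46)∕(2.49) applied to the new 𝐑-terms of the k-th step.

WHY THIS FILE (HUMAN RULING D-0062, Track A full width; DAG node N13 = [B16] Thm 1 + Cor 3; seat dag-n14-b rebalanced to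
«N13 Cor 3: trace the residual hypotheses of `uvIneq_of_repr172` to suppliers and prove the first one print derives»).  The
Cor 3 chain of the surge-node lineage `B14Cor3` → `B16Cor3` → `B16Cor3Scales` → `B16Cor3Ops` → `B16Cor3Wilson` →
`B16Cor3Torus` proves (2.50)∕(0.1) for one run and one step from (1.72) with, among its residual HYPOTHESES, the two-sided
bound on the curly bracket `hcurly : 0 ≤ {⋯} ∧ {⋯} ≤ e^{ε′N}` and, for the all-small term, `{⋯} = e^{Rre}`, `|Rre| ≤ εN`
(`B16Cor3Ops.Repr172.uvIneq_of_repr172` :458; no supplier anywhere in the tree).  Meanwhile the (1.90) gas was PROVED end to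
end by the p24 lineage (`B16Eq190Resummation`: Mayer step, (1.90)∕(1.91), (1.92)–(1.97), and (1.98)∕(1.99) through
`B16Exp198`'s Kotecký–Preiss certificate) — up to, but not including, the volume summation.  This module supplies it:
* §1 ABSTRACT TWO-FOOTPRINT LAYER (the polymer system of `B16Exp198`: catalogue `Λ`, outside footprint `out`, incompatibility
  footprint-local through `reach`, activities `|F(Z)| ≤ A e^{−R d(Z)}`, relative leaves (1.26)_rel `Ineq126` and `VolBound`,
  constants `κ₀ + τc₁ ≤ R`, `A e^{τc₁} K₀ ν ≤ τ` — VERBATIM the hypotheses of `B16Exp198.exp_sum_locR_eq_Z`, plus «every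
  polymer owns an outside cube»): the outside-cube-anchored activity sum `Σ_{Z∈Λ} |F(Z)| e^{τ|out Z|} ≤ #(⋃_{Z∈Λ} out Z)·
  A e^{τc₁} K₀` (`sum_kpTerm_le_card_mul`); the Kotecký–Preiss volume packaged (`isKPVolume_rel`); **`norm_polymerLogZ_le_card_mul`**
  (`|log Ξ| = |Σ_X 𝐑′^{(k)}(X)| ≤ #outside cubes · A e^{τc₁} K₀`, by `T4DilationKPLog.norm_polymerLogZ_le`); the two-sided
  modulus bound `e^{−b·#} ≤ |Ξ| ≤ e^{b·#}` (`norm_Z_le_exp`, `exp_neg_le_norm_Z`); and for REAL activities `Im Ξ = 0`,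
  `Re Ξ > 0` (`PolymerGasRatio.re_polymerPartitionFunction_pos_of_kp`) and `Ξ = e^{ρ}`, `ρ` real, `|ρ| ≤ b·#` (`exists_real_log_Z`).
* §2 THE GAS OF (1.90) (setting and hypotheses VERBATIM those of `B16Eq190Resummation.eq190_exp`: reflexive symmetric cube
  adjacency generated by neighbourhoods of `≤ ν` cubes, every item owning an outside cube, `TermMul`, `term ∅ ∅ = 1`, the
  (1.97)-shaped activity bound, the relative leaves, the constants): **`norm_sum_term_le_exp`** — `|Σ_{{X_j}}Σ_𝐃 term| ≤
  exp(c₁e^{τc_v}K₀ · #Q)`, `Q` = the outside cubes of the polymers; `exp_neg_le_norm_sum_term`; and for real terms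
  `re_sum_term_pos`, **`exists_log_sum_term`**; the outside-cube count `card_outsideCubes_le` (`#Q ≤ #{cubes ∉ ⋃Y_i} ≤ #cubes`; `Q = ⋃_{X′ polymer}(X′∖⋃Y_i)`, no definition introduced).
* §3 THE CURLY BRACKET ITSELF (`B16Eq190Resummation.bracket Op V φ`, hypotheses of `bracket_eq_exp_sum_locR` resp. of its
  `_of_localOps` form): `norm_bracket_le_exp(_of_localOps)`; reality of the Mayer terms from real `V(Y)` and reality-preserving
  operations (`mayerTerm_im_eq_zero`); `re_bracket_pos(_of_localOps)`, `exists_log_bracket(_of_localOps)`.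
* §4 THE SHAPES CONSUMED BY `uvIneq_of_repr172`: with `curly := ({⋯}).re` and `#Q ≤ πc·N`, `0 ≤ curly ∧ curly ≤ exp(ε′·N)` for
  `ε′ = πc·c₁e^{τc_v}K₀` (`hcurly_shape`) and `curly = exp ρ`, `|ρ| ≤ ε′·N` (`h0c_shape`) — the junction `R.curly a V :=
  (bracket_a V).re` is the knitter's (the `Repr172` data are abstract).

HONEST FRAMING.  Kernel bookkeeping over the LANDED Kotecký–Preiss theorems and the landed (1.90) gas; every hypothesis is
a hypothesis of `B16Exp198.exp_sum_locR_eq_Z` ∕ `B16Eq190Resummation.eq190_exp` or a reality clause.  Nothing of Bałaban's is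
asserted: whether the genuine curly bracket of (1.72) satisfies `TermMul`∕`LocalOps`, the (1.97)-shaped bound (GAPS: (1.68),
(1.73)·(1.89) leaves) and the relative geometric leaves on the lattice is exactly as open as before; the datum `hH`, the
factor-form object behind (1.79), the lower (2.49) bookkeeping (GAPS G-adv3-2) and the localization residual (G-pv06-4) of
the Cor 3 chain are untouched.  Not a discharge of N13; typed 28∕28 · discharged count unmoved; nothing continuum ∕ ℝ⁴ ∕ OS ∕
mass-gap ∕ Clay.  0 sorry, axioms standard; no existing module is modified.
-/

noncomputable section

namespace Literature.MathematicalPhysics.QuantumFieldTheory.Balaban1983to89.B16CurlyBracketVolume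

open Finset
open Literature.Probability.LatticeModels
open Literature.MathematicalPhysics.QuantumFieldTheory.Balaban1983to89.B13FamilySum (Ineq126 VolBound)
open Literature.MathematicalPhysics.QuantumFieldTheory.Balaban1983to89.B16Exp198 (locR logZ_eq_sum_locR kp_condition_rel
  exp_sum_locR_eq_Z)
open Literature.MathematicalPhysics.QuantumFieldTheory.Balaban1983to89.T4DilationKPLog (norm_polymerLogZ_le)
open Literature.MathematicalPhysics.QuantumFieldTheory.Balaban1983to89.B16Eq190Resummation

/-! ## §1 Abstract two-footprint layer: the volume bound of log Ξ, the two-sided modulus bound, reality -/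

section Abstract

variable {Dom Cube : Type*} [DecidableEq Dom] [DecidableEq Cube]
variable (ι : Dom → Dom → Prop) [DecidableRel ι]

omit [DecidableEq Dom] in
/-- **The outside-cube-anchored activity sum** — the «O(1)Σ_j|Γ_j|» step of [III] (2.46)∕(2.49) for the new 𝐑-terms: with the
(1.97)-shaped activity bound `|F(Z)| ≤ A e^{−R d(Z)}`, the relative volume bound `#out Z ≤ c₁(1 + d(Z))` (so that the
Kotecký–Preiss weight `e^{τ#out Z}` is absorbed by `κ₀ + τc₁ ≤ R`) and the relative anchored bound (1.26)_rel `Σ_{Z ∋ q} e^{−κ₀d(Z)}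
≤ K₀` at every OUTSIDE cube `q`, every polymer owning an outside cube: `Σ_{Z∈Λ} |F(Z)| e^{τ#out Z} ≤ #(⋃_{Z∈Λ} out Z) ·
A e^{τc₁} K₀`. [cite: Balaban1988Convergent, (2.46) p.263] -/
theorem sum_kpTerm_le_card_mul {Λ : Finset Dom} {out : Dom → Finset Cube} {d : Dom → ℝ} {w : Dom → ℂ}
    {A R κ₀ K₀ c₁ τ : ℝ} (hd : ∀ Z, 0 ≤ d Z) (hA : 0 ≤ A) (hτ : 0 ≤ τ)
    (hw : ∀ Z, ‖w Z‖ ≤ A * Real.exp (-(R * d Z))) (h126 : Ineq126 Λ out d κ₀ K₀) (hvol : VolBound Λ out d c₁)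
    (hrate : κ₀ + τ * c₁ ≤ R) (hout : ∀ Z ∈ Λ, (out Z).Nonempty) :
    ∑ Z ∈ Λ, ‖w Z‖ * Real.exp (τ * ((out Z).card : ℝ))
      ≤ ((Λ.biUnion out).card : ℝ) * (A * Real.exp (τ * c₁) * K₀) := by
  set f : Dom → ℝ := fun Z => ‖w Z‖ * Real.exp (τ * ((out Z).card : ℝ)) with hf
  have hf0 : ∀ Z, 0 ≤ f Z := fun Z => mul_nonneg (norm_nonneg _) (Real.exp_nonneg _)
  -- the pointwise bound `f Z ≤ A e^{τ c₁} e^{-κ₀ d(Z)}` on `Λ`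
  have hpt : ∀ Z ∈ Λ, f Z ≤ A * Real.exp (τ * c₁) * Real.exp (-(κ₀ * d Z)) := by
    intro Z hZΛ
    have hv : τ * ((out Z).card : ℝ) ≤ τ * (c₁ * (1 + d Z)) := mul_le_mul_of_nonneg_left (hvol Z hZΛ) hτ
    have hexp : -(R * d Z) + τ * (c₁ * (1 + d Z)) = τ * c₁ + -((R - τ * c₁) * d Z) := by ring
    calc f Z ≤ A * Real.exp (-(R * d Z)) * Real.exp (τ * (c₁ * (1 + d Z))) :=
          mul_le_mul (hw Z) (Real.exp_le_exp.2 hv) (Real.exp_nonneg _) (mul_nonneg hA (Real.exp_nonneg _))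
      _ = A * Real.exp (τ * c₁) * Real.exp (-((R - τ * c₁) * d Z)) := by
          rw [mul_assoc, ← Real.exp_add, hexp, Real.exp_add, ← mul_assoc]
      _ ≤ A * Real.exp (τ * c₁) * Real.exp (-(κ₀ * d Z)) := by
          refine mul_le_mul_of_nonneg_left (Real.exp_le_exp.2 (neg_le_neg ?_)) (mul_nonneg hA (Real.exp_nonneg _))
          exact mul_le_mul_of_nonneg_right (by linarith) (hd Z)
  -- (1.26)_rel per anchoring outside cube
  have hq : ∀ q, ∑ Z ∈ Λ.filter (fun Z => q ∈ out Z), f Z ≤ A * Real.exp (τ * c₁) * K₀ := fun q =>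
    calc ∑ Z ∈ Λ.filter (fun Z => q ∈ out Z), f Z
        ≤ ∑ Z ∈ Λ.filter (fun Z => q ∈ out Z), A * Real.exp (τ * c₁) * Real.exp (-(κ₀ * d Z)) :=
          Finset.sum_le_sum fun Z hZ => hpt Z (Finset.mem_filter.1 hZ).1
      _ = A * Real.exp (τ * c₁) * ∑ Z ∈ Λ.filter (fun Z => q ∈ out Z), Real.exp (-(κ₀ * d Z)) := by
          rw [Finset.mul_sum]
      _ ≤ A * Real.exp (τ * c₁) * K₀ :=
          mul_le_mul_of_nonneg_left (h126 q) (mul_nonneg hA (Real.exp_nonneg _))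
  -- every polymer is counted at least once at its outside cubes
  have hone : ∀ Z ∈ Λ, f Z ≤ ((out Z).card : ℝ) * f Z := fun Z hZ => by
    have h1 : (1 : ℝ) ≤ ((out Z).card : ℝ) := by exact_mod_cast Finset.card_pos.2 (hout Z hZ)
    exact le_mul_of_one_le_left (hf0 Z) h1
  have hswap : ∑ Z ∈ Λ, ∑ _q ∈ out Z, f Z = ∑ q ∈ Λ.biUnion out, ∑ Z ∈ Λ.filter (fun Z => q ∈ out Z), f Z := by
    refine Finset.sum_comm' ?_
    intro Z q
    simp only [Finset.mem_filter, Finset.mem_biUnion]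
    constructor
    · rintro ⟨hZ, hqZ⟩
      exact ⟨⟨hZ, hqZ⟩, Z, hZ, hqZ⟩
    · rintro ⟨⟨hZ, hqZ⟩, _⟩
      exact ⟨hZ, hqZ⟩
  calc ∑ Z ∈ Λ, f Z ≤ ∑ Z ∈ Λ, ((out Z).card : ℝ) * f Z := Finset.sum_le_sum hone
    _ = ∑ Z ∈ Λ, ∑ _q ∈ out Z, f Z := by
        refine Finset.sum_congr rfl fun Z _ => ?_
        rw [Finset.sum_const, nsmul_eq_mul]
    _ = ∑ q ∈ Λ.biUnion out, ∑ Z ∈ Λ.filter (fun Z => q ∈ out Z), f Z := hswap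
    _ ≤ ∑ _q ∈ Λ.biUnion out, A * Real.exp (τ * c₁) * K₀ := Finset.sum_le_sum fun q _ => hq q
    _ = ((Λ.biUnion out).card : ℝ) * (A * Real.exp (τ * c₁) * K₀) := by rw [Finset.sum_const, nsmul_eq_mul]

/-- **The Kotecký–Preiss volume of the relative gas, packaged** (the `IsKPVolume` of the whole polymer type with size
`a(Z) = τ·#out Z`, built inside `B16Exp198.exp_sum_locR_eq_Z` and re-exported here): from the hypotheses of
`B16Exp198.kp_condition_rel` with `s = b = 0`. [cite: KoteckyPreiss1986, Theorem p.492 (1)] -/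
theorem isKPVolume_rel [Fintype Dom] {Λ : Finset Dom} {out reach : Dom → Finset Cube} {d : Dom → ℝ} {w : Dom → ℂ}
    {A R κ₀ K₀ c₁ τ ν : ℝ} (hloc : ∀ Z, ∀ Z' ∈ Λ, ι Z' Z → ∃ q ∈ reach Z, q ∈ out Z')
    (hreach : ∀ Z, ((reach Z).card : ℝ) ≤ ν * (out Z).card) (hd : ∀ Z, 0 ≤ d Z) (hA : 0 ≤ A) (hK₀ : 0 ≤ K₀)
    (hτ : 0 ≤ τ) (hwΛ : ∀ Z, Z ∉ Λ → w Z = 0) (hw : ∀ Z, ‖w Z‖ ≤ A * Real.exp (-(R * d Z)))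
    (h126 : Ineq126 Λ out d κ₀ K₀) (hvol : VolBound Λ out d c₁) (hrate : κ₀ + τ * c₁ ≤ R)
    (hsmall : A * Real.exp (τ * c₁) * K₀ * ν ≤ τ) :
    IsKPVolume ι w (fun Z => τ * ((out Z).card : ℝ)) (Finset.univ : Finset Dom) := by
  have hkp := kp_condition_rel ι hloc hreach hd hA hK₀ hτ hwΛ hw h126 hvol (s := 0) (b := 0)
    (by simpa using hrate) (by simpa using hsmall)
  have h1 := fun γ => kp_hypothesis_of_fintype (inc := ι) (w := w)
    (a := fun Z => τ * ((out Z).card : ℝ)) (d := fun Z => 0 * d Z + 0) hkp γ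
  have hdK : ∀ Z, (0 : ℝ) ≤ 0 * d Z + 0 := fun Z => by simp
  exact isKPVolume_of_tsum_le (inc := ι) (w := w) (a := fun Z => τ * ((out Z).card : ℝ))
    (d := fun Z => 0 * d Z + 0) hdK h1 Finset.univ

/-- **THE VOLUME BOUND OF THE KOTECKÝ–PREISS LOGARITHM** — `|log Ξ_Λ| ≤ #(outside cubes of the polymers) · A e^{τc₁} K₀`:
the free-energy bound `|log Ξ_Λ| ≤ Σ_{Z∈Λ} |F(Z)| e^{a(Z)}` of the tree (`T4DilationKPLog.norm_polymerLogZ_le`, [KP86] Theorem)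
followed by the anchored sum `sum_kpTerm_le_card_mul` — the (2.46)∕(2.49)-type «O(1) per cube» bookkeeping of [III] for the
exponent of (1.98). [cite: Balaban1988Convergent, (2.49) p.264] -/
theorem norm_polymerLogZ_le_card_mul [Fintype Dom] [Std.Refl ι] [Std.Symm ι] {Λ : Finset Dom}
    {out reach : Dom → Finset Cube} {d : Dom → ℝ} {w : Dom → ℂ} {A R κ₀ K₀ c₁ τ ν : ℝ}
    (hloc : ∀ Z, ∀ Z' ∈ Λ, ι Z' Z → ∃ q ∈ reach Z, q ∈ out Z')
    (hreach : ∀ Z, ((reach Z).card : ℝ) ≤ ν * (out Z).card) (hd : ∀ Z, 0 ≤ d Z) (hA : 0 ≤ A) (hK₀ : 0 ≤ K₀)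
    (hτ : 0 ≤ τ) (hwΛ : ∀ Z, Z ∉ Λ → w Z = 0) (hw : ∀ Z, ‖w Z‖ ≤ A * Real.exp (-(R * d Z)))
    (h126 : Ineq126 Λ out d κ₀ K₀) (hvol : VolBound Λ out d c₁) (hrate : κ₀ + τ * c₁ ≤ R)
    (hsmall : A * Real.exp (τ * c₁) * K₀ * ν ≤ τ) (hout : ∀ Z ∈ Λ, (out Z).Nonempty) :
    ‖polymerLogZ ι w Λ‖ ≤ ((Λ.biUnion out).card : ℝ) * (A * Real.exp (τ * c₁) * K₀) := by
  have hKP := isKPVolume_rel ι hloc hreach hd hA hK₀ hτ hwΛ hw h126 hvol hrate hsmall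
  refine (norm_polymerLogZ_le hKP (Finset.subset_univ Λ)).trans ?_
  simp only [kpTerm]
  exact sum_kpTerm_le_card_mul hd hA hτ hw h126 hvol hrate hout

/-- The same bound for the localized form `Σ_X 𝐑′^{(k)}(X)` of the exponent of (1.98) (`B16Exp198.logZ_eq_sum_locR`).
[cite: Balaban1989LargeFieldII, (1.98) p.390] -/
theorem norm_sum_locR_le_card_mul [Fintype Dom] [Std.Refl ι] [Std.Symm ι] {Λ : Finset Dom}
    {cubes out reach : Dom → Finset Cube} {d : Dom → ℝ} {w : Dom → ℂ} {A R κ₀ K₀ c₁ τ ν : ℝ}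
    (hloc : ∀ Z, ∀ Z' ∈ Λ, ι Z' Z → ∃ q ∈ reach Z, q ∈ out Z')
    (hreach : ∀ Z, ((reach Z).card : ℝ) ≤ ν * (out Z).card) (hd : ∀ Z, 0 ≤ d Z) (hA : 0 ≤ A) (hK₀ : 0 ≤ K₀)
    (hτ : 0 ≤ τ) (hwΛ : ∀ Z, Z ∉ Λ → w Z = 0) (hw : ∀ Z, ‖w Z‖ ≤ A * Real.exp (-(R * d Z)))
    (h126 : Ineq126 Λ out d κ₀ K₀) (hvol : VolBound Λ out d c₁) (hrate : κ₀ + τ * c₁ ≤ R)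
    (hsmall : A * Real.exp (τ * c₁) * K₀ * ν ≤ τ) (hout : ∀ Z ∈ Λ, (out Z).Nonempty) :
    ‖∑ X ∈ Λ.powerset.image (fun C => C.biUnion cubes), locR ι Λ cubes w X‖
      ≤ ((Λ.biUnion out).card : ℝ) * (A * Real.exp (τ * c₁) * K₀) := by
  rw [← logZ_eq_sum_locR]
  exact norm_polymerLogZ_le_card_mul ι hloc hreach hd hA hK₀ hτ hwΛ hw h126 hvol hrate hsmall hout

/-- **UPPER MODULUS BOUND OF THE PARTITION FUNCTION**: `|Ξ_Λ| ≤ exp(#outside cubes · A e^{τc₁} K₀)` (`Ξ = exp log Ξ`,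
`|e^{L}| = e^{Re L} ≤ e^{|L|}`) — the `exp E₊|T_η|` side of (2.50) for the curly bracket. [cite: Balaban1988Convergent, (2.50) p.264] -/
theorem norm_Z_le_exp [Fintype Dom] [Std.Refl ι] [Std.Symm ι] {Λ : Finset Dom}
    {out reach : Dom → Finset Cube} {d : Dom → ℝ} {w : Dom → ℂ} {A R κ₀ K₀ c₁ τ ν : ℝ}
    (hloc : ∀ Z, ∀ Z' ∈ Λ, ι Z' Z → ∃ q ∈ reach Z, q ∈ out Z')
    (hreach : ∀ Z, ((reach Z).card : ℝ) ≤ ν * (out Z).card) (hd : ∀ Z, 0 ≤ d Z) (hA : 0 ≤ A) (hK₀ : 0 ≤ K₀)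
    (hτ : 0 ≤ τ) (hwΛ : ∀ Z, Z ∉ Λ → w Z = 0) (hw : ∀ Z, ‖w Z‖ ≤ A * Real.exp (-(R * d Z)))
    (h126 : Ineq126 Λ out d κ₀ K₀) (hvol : VolBound Λ out d c₁) (hrate : κ₀ + τ * c₁ ≤ R)
    (hsmall : A * Real.exp (τ * c₁) * K₀ * ν ≤ τ) (hout : ∀ Z ∈ Λ, (out Z).Nonempty) :
    ‖polymerPartitionFunction ι w Λ‖ ≤ Real.exp (((Λ.biUnion out).card : ℝ) * (A * Real.exp (τ * c₁) * K₀)) := by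
  have hKP := isKPVolume_rel ι hloc hreach hd hA hK₀ hτ hwΛ hw h126 hvol hrate hsmall
  have hlog := norm_polymerLogZ_le_card_mul ι hloc hreach hd hA hK₀ hτ hwΛ hw h126 hvol hrate hsmall hout
  rw [← exp_polymerLogZ_of_kp hKP (Finset.subset_univ Λ), Complex.norm_exp]
  exact Real.exp_le_exp.2 ((Complex.re_le_norm _).trans hlog)

/-- **LOWER MODULUS BOUND OF THE PARTITION FUNCTION**: `exp(−#outside cubes · A e^{τc₁} K₀) ≤ |Ξ_Λ|` — the `e^{−E₋|T_η|}`
side of (2.50) for the curly bracket. [cite: Balaban1988Convergent, (2.50) p.264] -/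
theorem exp_neg_le_norm_Z [Fintype Dom] [Std.Refl ι] [Std.Symm ι] {Λ : Finset Dom}
    {out reach : Dom → Finset Cube} {d : Dom → ℝ} {w : Dom → ℂ} {A R κ₀ K₀ c₁ τ ν : ℝ}
    (hloc : ∀ Z, ∀ Z' ∈ Λ, ι Z' Z → ∃ q ∈ reach Z, q ∈ out Z')
    (hreach : ∀ Z, ((reach Z).card : ℝ) ≤ ν * (out Z).card) (hd : ∀ Z, 0 ≤ d Z) (hA : 0 ≤ A) (hK₀ : 0 ≤ K₀)
    (hτ : 0 ≤ τ) (hwΛ : ∀ Z, Z ∉ Λ → w Z = 0) (hw : ∀ Z, ‖w Z‖ ≤ A * Real.exp (-(R * d Z)))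
    (h126 : Ineq126 Λ out d κ₀ K₀) (hvol : VolBound Λ out d c₁) (hrate : κ₀ + τ * c₁ ≤ R)
    (hsmall : A * Real.exp (τ * c₁) * K₀ * ν ≤ τ) (hout : ∀ Z ∈ Λ, (out Z).Nonempty) :
    Real.exp (-(((Λ.biUnion out).card : ℝ) * (A * Real.exp (τ * c₁) * K₀))) ≤ ‖polymerPartitionFunction ι w Λ‖ := by
  have hKP := isKPVolume_rel ι hloc hreach hd hA hK₀ hτ hwΛ hw h126 hvol hrate hsmall
  have hlog := norm_polymerLogZ_le_card_mul ι hloc hreach hd hA hK₀ hτ hwΛ hw h126 hvol hrate hsmall hout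
  rw [← exp_polymerLogZ_of_kp hKP (Finset.subset_univ Λ), Complex.norm_exp]
  refine Real.exp_le_exp.2 ?_
  have h := Complex.abs_re_le_norm (polymerLogZ ι w Λ)
  have h' := (abs_le.1 (h.trans hlog)).1
  linarith

/-- With REAL activities every partition function along the real ray `t ↦ t·F` is real. [folklore] -/
private theorem im_Z_ray_eq_zero {w : Dom → ℂ} (hreal : ∀ Z, (w Z).im = 0) (Λ : Finset Dom) (t : ℝ) :
    (polymerPartitionFunction ι (fun Z => (t : ℂ) * w Z) Λ).im = 0 :=
  im_polymerPartitionFunction_eq_zero (fun Z => by simp [Complex.mul_im, hreal Z]) Λ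

/-- **REALITY AND POSITIVITY FOR REAL DATA**: with real activities (print: *"All the expressions in the definition (1.71),
for the configuration U, are real"*, p. 379; the curly bracket at a real configuration) the partition function is real and
POSITIVE — positivity by continuity along `t ↦ t·F` under the Kotecký–Preiss condition (tree
`PolymerGasRatio.re_polymerPartitionFunction_pos_of_kp`). [cite: Balaban1989LargeFieldII, (1.98) p.390] -/
theorem re_Z_pos [Fintype Dom] [Std.Refl ι] [Std.Symm ι] {Λ : Finset Dom}
    {out reach : Dom → Finset Cube} {d : Dom → ℝ} {w : Dom → ℂ} {A R κ₀ K₀ c₁ τ ν : ℝ}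
    (hloc : ∀ Z, ∀ Z' ∈ Λ, ι Z' Z → ∃ q ∈ reach Z, q ∈ out Z')
    (hreach : ∀ Z, ((reach Z).card : ℝ) ≤ ν * (out Z).card) (hd : ∀ Z, 0 ≤ d Z) (hA : 0 ≤ A) (hK₀ : 0 ≤ K₀)
    (hτ : 0 ≤ τ) (hwΛ : ∀ Z, Z ∉ Λ → w Z = 0) (hw : ∀ Z, ‖w Z‖ ≤ A * Real.exp (-(R * d Z)))
    (h126 : Ineq126 Λ out d κ₀ K₀) (hvol : VolBound Λ out d c₁) (hrate : κ₀ + τ * c₁ ≤ R)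
    (hsmall : A * Real.exp (τ * c₁) * K₀ * ν ≤ τ) (hreal : ∀ Z, (w Z).im = 0) :
    (polymerPartitionFunction ι w Λ).im = 0 ∧ 0 < (polymerPartitionFunction ι w Λ).re := by
  have hKP := isKPVolume_rel ι hloc hreach hd hA hK₀ hτ hwΛ hw h126 hvol hrate hsmall
  exact ⟨im_polymerPartitionFunction_eq_zero hreal Λ,
    re_polymerPartitionFunction_pos_of_kp hKP (Finset.subset_univ Λ) fun t _ => im_Z_ray_eq_zero ι hreal Λ t⟩

/-- A complex number that is real, positive and equal to `exp L` is `exp (Re L)` — so it has a REAL logarithm bounded by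
`|L|`. [folklore] -/
private theorem eq_exp_re_of_real {z L : ℂ} (hz : z = Complex.exp L) (him : z.im = 0) (hre : 0 < z.re) :
    z = ((Real.exp L.re : ℝ) : ℂ) := by
  have hnorm : ‖z‖ = Real.exp L.re := by rw [hz, Complex.norm_exp]
  have hzre : z = ((z.re : ℝ) : ℂ) := Complex.ext (by simp) (by simp [him])
  have hre' : z.re = ‖z‖ := by
    conv_rhs => rw [hzre]
    rw [Complex.norm_real, Real.norm_eq_abs, abs_of_pos hre]
  rw [hzre, hre', hnorm]

/-- **A REAL LOGARITHM FOR REAL DATA**: with real activities `Ξ_Λ = e^{ρ}` for a REAL `ρ` with `|ρ| ≤ #outside cubes ·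
A e^{τc₁} K₀` (`ρ = Re log Ξ`) — the shape `{⋯} = exp Rre`, `|Rre| ≤ ε·N` in which the Cor 3 chain reads the all-small term.
[cite: Balaban1989LargeFieldII, (1.98) p.390] -/
theorem exists_real_log_Z [Fintype Dom] [Std.Refl ι] [Std.Symm ι] {Λ : Finset Dom}
    {out reach : Dom → Finset Cube} {d : Dom → ℝ} {w : Dom → ℂ} {A R κ₀ K₀ c₁ τ ν : ℝ}
    (hloc : ∀ Z, ∀ Z' ∈ Λ, ι Z' Z → ∃ q ∈ reach Z, q ∈ out Z')
    (hreach : ∀ Z, ((reach Z).card : ℝ) ≤ ν * (out Z).card) (hd : ∀ Z, 0 ≤ d Z) (hA : 0 ≤ A) (hK₀ : 0 ≤ K₀)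
    (hτ : 0 ≤ τ) (hwΛ : ∀ Z, Z ∉ Λ → w Z = 0) (hw : ∀ Z, ‖w Z‖ ≤ A * Real.exp (-(R * d Z)))
    (h126 : Ineq126 Λ out d κ₀ K₀) (hvol : VolBound Λ out d c₁) (hrate : κ₀ + τ * c₁ ≤ R)
    (hsmall : A * Real.exp (τ * c₁) * K₀ * ν ≤ τ) (hout : ∀ Z ∈ Λ, (out Z).Nonempty) (hreal : ∀ Z, (w Z).im = 0) :
    ∃ ρ : ℝ, |ρ| ≤ ((Λ.biUnion out).card : ℝ) * (A * Real.exp (τ * c₁) * K₀) ∧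
      polymerPartitionFunction ι w Λ = ((Real.exp ρ : ℝ) : ℂ) := by
  have hKP := isKPVolume_rel ι hloc hreach hd hA hK₀ hτ hwΛ hw h126 hvol hrate hsmall
  have hlog := norm_polymerLogZ_le_card_mul ι hloc hreach hd hA hK₀ hτ hwΛ hw h126 hvol hrate hsmall hout
  obtain ⟨him, hre⟩ := re_Z_pos ι hloc hreach hd hA hK₀ hτ hwΛ hw h126 hvol hrate hsmall hreal
  refine ⟨(polymerLogZ ι w Λ).re, (Complex.abs_re_le_norm _).trans hlog, ?_⟩
  exact eq_exp_re_of_real (exp_polymerLogZ_of_kp hKP (Finset.subset_univ Λ)).symm him hre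

end Abstract

/-! ## §2 The gas of (1.90): the volume bound of the exponentiated two-sorted sum -/

section Gas

variable {LF DomY Cube : Type*} [DecidableEq Cube] {adjC : Cube → Cube → Prop}
  {locX : LF → Finset Cube} {locY : DomY → Finset Cube} {Yfix : Finset Cube}

/-- THE OUTSIDE CUBES `Q = ⋃_{X′ polymer} (X′ ∖ ⋃_i Y_i)` at which the activities are anchored in the volume summation (print's
`|T_η|`-bookkeeping counts M-cubes; the fixed regions ⋃_i Y_i carry no anchor — p. 391: *"there are no summations over these
domains, they are fixed"*) are cubes off ⋃_i Y_i: on a finite cube type `#Q ≤ #{cubes ∉ ⋃Y_i} ≤ #cubes` (the `|T_η|`-linear form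
of the bound). [cite: Balaban1989LargeFieldII, (1.98) p.390] -/
theorem card_outsideCubes_le [Fintype LF] [Fintype DomY] [Fintype Cube] [DecidableEq LF] [DecidableEq DomY] :
    ((polys190 adjC locX locY Yfix).biUnion fun X => X \ Yfix).card ≤ (Finset.univ.filter fun q : Cube => q ∉ Yfix).card ∧
      (Finset.univ.filter fun q : Cube => q ∉ Yfix).card ≤ Fintype.card Cube := by
  refine ⟨Finset.card_le_card fun q hq => ?_, Finset.card_filter_le _ _⟩
  obtain ⟨X, -, hqX⟩ := Finset.mem_biUnion.1 hq
  exact Finset.mem_filter.2 ⟨Finset.mem_univ q, (Finset.mem_sdiff.1 hqX).2⟩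

/-- Every polymer of (1.90) owns an outside cube (every X_j and every Y does). [cite: Balaban1989LargeFieldII, (1.90) p.388] -/
theorem outside_nonempty_of_mem_polys190 [Fintype LF] [Fintype DomY] [DecidableEq LF] [DecidableEq DomY]
    (hrefl : ∀ a, adjC a a) (houtX : ∀ j, (locX j \ Yfix).Nonempty) (houtY : ∀ Y, (locY Y \ Yfix).Nonempty)
    {X : Finset Cube} (hX : X ∈ polys190 adjC locX locY Yfix) : (X \ Yfix).Nonempty := by
  obtain ⟨a, ha, -⟩ := pinc_refl_of_mem_polys190 hrefl houtX houtY hX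
  exact ⟨a, ha⟩

/-- The activities (1.91) of REAL terms are real. [folklore] -/
private theorem F191_im_eq_zero [Fintype LF] [Fintype DomY] [DecidableEq LF] [DecidableEq DomY]
    {term : Finset LF → Finset DomY → ℂ} (hreal : ∀ S D, (term S D).im = 0) (X : Finset Cube) :
    (F191 adjC locX locY Yfix term X).im = 0 := by
  classical
  unfold F191
  rw [Complex.im_sum]
  exact Finset.sum_eq_zero fun p _ => hreal p.1 p.2

/-- **THE VOLUME BOUND FOR THE GAS OF (1.90)** — under the hypotheses of `B16Eq190Resummation.eq190_exp` VERBATIM (terms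
factorizing in the components, `term ∅ ∅ = 1`, every item owning an outside cube, reflexive symmetric footprint-local cube
adjacency, the (1.97)-shaped activity bound, the relative leaves, the Kotecký–Preiss constants):
`|Σ_{{X_j}} Σ_𝐃 term| ≤ exp(c₁ e^{τc_v} K₀ · #outside cubes)` — (1.90) (`eq190`) + the volume bound of §1 for the gas on the
reflexive closure `pincR` of the printed incompatibility. [cite: Balaban1989LargeFieldII, (1.98) p.390] -/
theorem norm_sum_term_le_exp [Fintype LF] [Fintype DomY] [Fintype Cube] [DecidableEq LF] [DecidableEq DomY]
    [DecidableRel adjC] (hrefl : ∀ a, adjC a a) (hsymm : ∀ a b, adjC a b → adjC b a)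
    (houtX : ∀ j, (locX j \ Yfix).Nonempty) (houtY : ∀ Y, (locY Y \ Yfix).Nonempty)
    {term : Finset LF → Finset DomY → ℂ} (h0 : term ∅ ∅ = 1) (hmul : TermMul adjC locX locY Yfix term)
    {nbr : Cube → Finset Cube} (hnbr : ∀ a b, adjC a b → a ∈ nbr b) {ν : ℝ} (hν : ∀ b, ((nbr b).card : ℝ) ≤ ν)
    {d : Finset Cube → ℝ} {c₁ R κ₀ K₀ cv τ : ℝ} (hd : ∀ X, 0 ≤ d X) (hc₁ : 0 ≤ c₁) (hK₀ : 0 ≤ K₀) (hτ : 0 ≤ τ)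
    (h197 : ∀ X, ‖F191 adjC locX locY Yfix term X‖ ≤ c₁ * Real.exp (-(R * d X)))
    (h126 : Ineq126 (polys190 adjC locX locY Yfix) (fun X => X \ Yfix) d κ₀ K₀)
    (hvol : VolBound (polys190 adjC locX locY Yfix) (fun X => X \ Yfix) d cv)
    (hrate : κ₀ + τ * cv ≤ R) (hsmall : c₁ * Real.exp (τ * cv) * K₀ * ν ≤ τ) :
    ‖∑ S : Finset LF, ∑ D : Finset DomY, term S D‖
      ≤ Real.exp ((((polys190 adjC locX locY Yfix).biUnion fun X => X \ Yfix).card : ℝ) * (c₁ * Real.exp (τ * cv) * K₀)) := by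
  have hΛ : ∀ X ∈ polys190 adjC locX locY Yfix, pinc adjC Yfix X X := fun X hX =>
    pinc_refl_of_mem_polys190 hrefl houtX houtY hX
  haveI : Std.Symm (pincR adjC Yfix) := ⟨fun X X' h => pincR_symm hsymm h⟩
  rw [eq190 hrefl hsymm houtX houtY h0 hmul, ← polymerPartitionFunction_pincR hΛ]
  exact norm_Z_le_exp (pincR adjC Yfix) (Λ := polys190 adjC locX locY Yfix) (out := fun X => X \ Yfix)
    (reach := fun Z => (Z \ Yfix).biUnion nbr) (d := d) (w := F191 adjC locX locY Yfix term)
    (fun Z Z' hZ' h => exists_reach_of_pincR hrefl hnbr hΛ Z Z' hZ' h) (fun Z => card_biUnion_nbr_le hν _)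
    hd hc₁ hK₀ hτ (fun Z hZ => F191_eq_zero_of_not_mem term hZ) h197 h126 hvol hrate hsmall
    (fun X hX => outside_nonempty_of_mem_polys190 hrefl houtX houtY hX)

/-- The lower companion: `exp(−c₁ e^{τc_v} K₀ · #outside cubes) ≤ |Σ_{{X_j}} Σ_𝐃 term|`. [cite: Balaban1989LargeFieldII, (1.98) p.390] -/
theorem exp_neg_le_norm_sum_term [Fintype LF] [Fintype DomY] [Fintype Cube] [DecidableEq LF] [DecidableEq DomY]
    [DecidableRel adjC] (hrefl : ∀ a, adjC a a) (hsymm : ∀ a b, adjC a b → adjC b a)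
    (houtX : ∀ j, (locX j \ Yfix).Nonempty) (houtY : ∀ Y, (locY Y \ Yfix).Nonempty)
    {term : Finset LF → Finset DomY → ℂ} (h0 : term ∅ ∅ = 1) (hmul : TermMul adjC locX locY Yfix term)
    {nbr : Cube → Finset Cube} (hnbr : ∀ a b, adjC a b → a ∈ nbr b) {ν : ℝ} (hν : ∀ b, ((nbr b).card : ℝ) ≤ ν)
    {d : Finset Cube → ℝ} {c₁ R κ₀ K₀ cv τ : ℝ} (hd : ∀ X, 0 ≤ d X) (hc₁ : 0 ≤ c₁) (hK₀ : 0 ≤ K₀) (hτ : 0 ≤ τ)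
    (h197 : ∀ X, ‖F191 adjC locX locY Yfix term X‖ ≤ c₁ * Real.exp (-(R * d X)))
    (h126 : Ineq126 (polys190 adjC locX locY Yfix) (fun X => X \ Yfix) d κ₀ K₀)
    (hvol : VolBound (polys190 adjC locX locY Yfix) (fun X => X \ Yfix) d cv)
    (hrate : κ₀ + τ * cv ≤ R) (hsmall : c₁ * Real.exp (τ * cv) * K₀ * ν ≤ τ) :
    Real.exp (-((((polys190 adjC locX locY Yfix).biUnion fun X => X \ Yfix).card : ℝ) * (c₁ * Real.exp (τ * cv) * K₀)))
      ≤ ‖∑ S : Finset LF, ∑ D : Finset DomY, term S D‖ := by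
  have hΛ : ∀ X ∈ polys190 adjC locX locY Yfix, pinc adjC Yfix X X := fun X hX =>
    pinc_refl_of_mem_polys190 hrefl houtX houtY hX
  haveI : Std.Symm (pincR adjC Yfix) := ⟨fun X X' h => pincR_symm hsymm h⟩
  rw [eq190 hrefl hsymm houtX houtY h0 hmul, ← polymerPartitionFunction_pincR hΛ]
  exact exp_neg_le_norm_Z (pincR adjC Yfix) (Λ := polys190 adjC locX locY Yfix) (out := fun X => X \ Yfix)
    (reach := fun Z => (Z \ Yfix).biUnion nbr) (d := d) (w := F191 adjC locX locY Yfix term)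
    (fun Z Z' hZ' h => exists_reach_of_pincR hrefl hnbr hΛ Z Z' hZ' h) (fun Z => card_biUnion_nbr_le hν _)
    hd hc₁ hK₀ hτ (fun Z hZ => F191_eq_zero_of_not_mem term hZ) h197 h126 hvol hrate hsmall
    (fun X hX => outside_nonempty_of_mem_polys190 hrefl houtX houtY hX)

/-- **REALITY AND POSITIVITY OF THE TWO-SORTED SUM FOR REAL TERMS** (print p. 379: *"All the expressions in the definition
(1.71), for the configuration U, are real, and the exponential density in the integral is positive"*; here: real terms ⟹ real
activities ⟹ a real, positive exponentiated gas). [cite: Balaban1989LargeFieldII, (1.98) p.390] -/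
theorem re_sum_term_pos [Fintype LF] [Fintype DomY] [Fintype Cube] [DecidableEq LF] [DecidableEq DomY]
    [DecidableRel adjC] (hrefl : ∀ a, adjC a a) (hsymm : ∀ a b, adjC a b → adjC b a)
    (houtX : ∀ j, (locX j \ Yfix).Nonempty) (houtY : ∀ Y, (locY Y \ Yfix).Nonempty)
    {term : Finset LF → Finset DomY → ℂ} (h0 : term ∅ ∅ = 1) (hmul : TermMul adjC locX locY Yfix term)
    {nbr : Cube → Finset Cube} (hnbr : ∀ a b, adjC a b → a ∈ nbr b) {ν : ℝ} (hν : ∀ b, ((nbr b).card : ℝ) ≤ ν)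
    {d : Finset Cube → ℝ} {c₁ R κ₀ K₀ cv τ : ℝ} (hd : ∀ X, 0 ≤ d X) (hc₁ : 0 ≤ c₁) (hK₀ : 0 ≤ K₀) (hτ : 0 ≤ τ)
    (h197 : ∀ X, ‖F191 adjC locX locY Yfix term X‖ ≤ c₁ * Real.exp (-(R * d X)))
    (h126 : Ineq126 (polys190 adjC locX locY Yfix) (fun X => X \ Yfix) d κ₀ K₀)
    (hvol : VolBound (polys190 adjC locX locY Yfix) (fun X => X \ Yfix) d cv)
    (hrate : κ₀ + τ * cv ≤ R) (hsmall : c₁ * Real.exp (τ * cv) * K₀ * ν ≤ τ)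
    (hreal : ∀ S D, (term S D).im = 0) :
    (∑ S : Finset LF, ∑ D : Finset DomY, term S D).im = 0 ∧ 0 < (∑ S : Finset LF, ∑ D : Finset DomY, term S D).re := by
  have hΛ : ∀ X ∈ polys190 adjC locX locY Yfix, pinc adjC Yfix X X := fun X hX =>
    pinc_refl_of_mem_polys190 hrefl houtX houtY hX
  haveI : Std.Symm (pincR adjC Yfix) := ⟨fun X X' h => pincR_symm hsymm h⟩
  rw [eq190 hrefl hsymm houtX houtY h0 hmul, ← polymerPartitionFunction_pincR hΛ]
  exact re_Z_pos (pincR adjC Yfix) (Λ := polys190 adjC locX locY Yfix) (out := fun X => X \ Yfix)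
    (reach := fun Z => (Z \ Yfix).biUnion nbr) (d := d) (w := F191 adjC locX locY Yfix term)
    (fun Z Z' hZ' h => exists_reach_of_pincR hrefl hnbr hΛ Z Z' hZ' h) (fun Z => card_biUnion_nbr_le hν _)
    hd hc₁ hK₀ hτ (fun Z hZ => F191_eq_zero_of_not_mem term hZ) h197 h126 hvol hrate hsmall
    (fun X => F191_im_eq_zero hreal X)

/-- **A REAL LOGARITHM OF THE TWO-SORTED SUM FOR REAL TERMS**: `Σ_{{X_j}}Σ_𝐃 term = e^{ρ}`, `ρ` real,
`|ρ| ≤ c₁e^{τc_v}K₀ · #outside cubes` — `ρ = Re Σ_X 𝐑′^{(k)}(X)`. [cite: Balaban1989LargeFieldII, (1.98) p.390] -/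
theorem exists_log_sum_term [Fintype LF] [Fintype DomY] [Fintype Cube] [DecidableEq LF] [DecidableEq DomY]
    [DecidableRel adjC] (hrefl : ∀ a, adjC a a) (hsymm : ∀ a b, adjC a b → adjC b a)
    (houtX : ∀ j, (locX j \ Yfix).Nonempty) (houtY : ∀ Y, (locY Y \ Yfix).Nonempty)
    {term : Finset LF → Finset DomY → ℂ} (h0 : term ∅ ∅ = 1) (hmul : TermMul adjC locX locY Yfix term)
    {nbr : Cube → Finset Cube} (hnbr : ∀ a b, adjC a b → a ∈ nbr b) {ν : ℝ} (hν : ∀ b, ((nbr b).card : ℝ) ≤ ν)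
    {d : Finset Cube → ℝ} {c₁ R κ₀ K₀ cv τ : ℝ} (hd : ∀ X, 0 ≤ d X) (hc₁ : 0 ≤ c₁) (hK₀ : 0 ≤ K₀) (hτ : 0 ≤ τ)
    (h197 : ∀ X, ‖F191 adjC locX locY Yfix term X‖ ≤ c₁ * Real.exp (-(R * d X)))
    (h126 : Ineq126 (polys190 adjC locX locY Yfix) (fun X => X \ Yfix) d κ₀ K₀)
    (hvol : VolBound (polys190 adjC locX locY Yfix) (fun X => X \ Yfix) d cv)
    (hrate : κ₀ + τ * cv ≤ R) (hsmall : c₁ * Real.exp (τ * cv) * K₀ * ν ≤ τ)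
    (hreal : ∀ S D, (term S D).im = 0) :
    ∃ ρ : ℝ, |ρ| ≤ (((polys190 adjC locX locY Yfix).biUnion fun X => X \ Yfix).card : ℝ) * (c₁ * Real.exp (τ * cv) * K₀) ∧
      ∑ S : Finset LF, ∑ D : Finset DomY, term S D = ((Real.exp ρ : ℝ) : ℂ) := by
  have hΛ : ∀ X ∈ polys190 adjC locX locY Yfix, pinc adjC Yfix X X := fun X hX =>
    pinc_refl_of_mem_polys190 hrefl houtX houtY hX
  haveI : Std.Symm (pincR adjC Yfix) := ⟨fun X X' h => pincR_symm hsymm h⟩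
  rw [eq190 hrefl hsymm houtX houtY h0 hmul, ← polymerPartitionFunction_pincR hΛ]
  exact exists_real_log_Z (pincR adjC Yfix) (Λ := polys190 adjC locX locY Yfix) (out := fun X => X \ Yfix)
    (reach := fun Z => (Z \ Yfix).biUnion nbr) (d := d) (w := F191 adjC locX locY Yfix term)
    (fun Z Z' hZ' h => exists_reach_of_pincR hrefl hnbr hΛ Z Z' hZ' h) (fun Z => card_biUnion_nbr_le hν _)
    hd hc₁ hK₀ hτ (fun Z hZ => F191_eq_zero_of_not_mem term hZ) h197 h126 hvol hrate hsmall
    (fun X hX => outside_nonempty_of_mem_polys190 hrefl houtX houtY hX) (fun X => F191_im_eq_zero hreal X)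

end Gas

/-! ## §3 The curly bracket of (1.72) itself -/

section Bracket

variable {LF DomY Cube Φ : Type*} [DecidableEq Cube] {adjC : Cube → Cube → Prop}
  {locX : LF → Finset Cube} {locY : DomY → Finset Cube} {Yfix : Finset Cube}

/-- **THE MODULUS BOUND OF THE CURLY BRACKET OF (1.72)** — `|{⋯}| ≤ exp(c₁e^{τc_v}K₀ · #outside cubes)` under the hypotheses
of `B16Eq190Resummation.bracket_eq_exp_sum_locR` VERBATIM (the Mayer terms factorize in the components, `Op ∅ = id`, every
item owns an outside cube, the (1.97)-shaped bound on the activities of the Mayer terms, the relative leaves, the constants).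
[cite: Balaban1989LargeFieldII, (1.98) p.390] -/
theorem norm_bracket_le_exp [Fintype LF] [Fintype DomY] [Fintype Cube] [DecidableEq LF] [DecidableEq DomY]
    [DecidableRel adjC] (hrefl : ∀ a, adjC a a) (hsymm : ∀ a b, adjC a b → adjC b a)
    (houtX : ∀ j, (locX j \ Yfix).Nonempty) (houtY : ∀ Y, (locY Y \ Yfix).Nonempty)
    (Op : Finset LF → (Φ → ℂ) →+ (Φ → ℂ)) (V : DomY → Φ → ℂ) (φ : Φ) (hOp0 : ∀ f, Op ∅ f = f)
    (hmul : TermMul adjC locX locY Yfix (mayerTerm Op V φ))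
    {nbr : Cube → Finset Cube} (hnbr : ∀ a b, adjC a b → a ∈ nbr b) {ν : ℝ} (hν : ∀ b, ((nbr b).card : ℝ) ≤ ν)
    {d : Finset Cube → ℝ} {c₁ R κ₀ K₀ cv τ : ℝ} (hd : ∀ X, 0 ≤ d X) (hc₁ : 0 ≤ c₁) (hK₀ : 0 ≤ K₀) (hτ : 0 ≤ τ)
    (h197 : ∀ X, ‖F191 adjC locX locY Yfix (mayerTerm Op V φ) X‖ ≤ c₁ * Real.exp (-(R * d X)))
    (h126 : Ineq126 (polys190 adjC locX locY Yfix) (fun X => X \ Yfix) d κ₀ K₀)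
    (hvol : VolBound (polys190 adjC locX locY Yfix) (fun X => X \ Yfix) d cv)
    (hrate : κ₀ + τ * cv ≤ R) (hsmall : c₁ * Real.exp (τ * cv) * K₀ * ν ≤ τ) :
    ‖bracket Op V φ‖ ≤ Real.exp ((((polys190 adjC locX locY Yfix).biUnion fun X => X \ Yfix).card : ℝ) * (c₁ * Real.exp (τ * cv) * K₀)) := by
  rw [bracket_eq_sum_mayerTerm]
  exact norm_sum_term_le_exp hrefl hsymm houtX houtY (by simp [mayerTerm, hOp0]) hmul hnbr hν hd hc₁ hK₀ hτ h197
    h126 hvol hrate hsmall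

/-- **REALITY OF THE MAYER TERMS** from real localization terms `V(Y)` and reality-preserving operations (the 𝐓′_k at a real
configuration are integrals against positive densities, p. 379–380): `∫₀¹e^{tV}V dt = e^{V} − 1` (`B13MayerDecoupling.integral_exp_mul_eq`)
is real for real `V`, so is the product over `𝐃`, hence `Op{X_j}` of it. [cite: Balaban1989LargeFieldII, (1.91) p.388] -/
theorem mayerTerm_im_eq_zero (Op : Finset LF → (Φ → ℂ) →+ (Φ → ℂ)) {V : DomY → Φ → ℂ}
    (hOpReal : ∀ (S : Finset LF) (f : Φ → ℂ), (∀ ψ, (f ψ).im = 0) → ∀ φ, (Op S f φ).im = 0)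
    (hVreal : ∀ Y ψ, (V Y ψ).im = 0) (φ : Φ) (S : Finset LF) (D : Finset DomY) :
    (mayerTerm Op V φ S D).im = 0 := by
  unfold mayerTerm
  refine hOpReal S _ (fun ψ => ?_) φ
  have hfac : ∀ Y ∈ D, (∫ t in (0 : ℝ)..1, Complex.exp ((t : ℂ) * V Y ψ) * V Y ψ) =
      (((Real.exp (V Y ψ).re - 1 : ℝ)) : ℂ) := by
    intro Y _
    rw [B13MayerDecoupling.integral_exp_mul_eq]
    refine Complex.ext ?_ ?_
    · simp [Complex.exp_re, hVreal Y ψ]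
    · simp [Complex.exp_im, hVreal Y ψ]
  rw [Finset.prod_congr rfl hfac, ← Complex.ofReal_prod, Complex.ofReal_im]

/-- **POSITIVITY OF THE CURLY BRACKET AT A REAL CONFIGURATION**: under the hypotheses of `norm_bracket_le_exp` and reality of
the Mayer terms, `{⋯}` is real and `> 0`. [cite: Balaban1989LargeFieldII, (1.98) p.390] -/
theorem re_bracket_pos [Fintype LF] [Fintype DomY] [Fintype Cube] [DecidableEq LF] [DecidableEq DomY]
    [DecidableRel adjC] (hrefl : ∀ a, adjC a a) (hsymm : ∀ a b, adjC a b → adjC b a)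
    (houtX : ∀ j, (locX j \ Yfix).Nonempty) (houtY : ∀ Y, (locY Y \ Yfix).Nonempty)
    (Op : Finset LF → (Φ → ℂ) →+ (Φ → ℂ)) (V : DomY → Φ → ℂ) (φ : Φ) (hOp0 : ∀ f, Op ∅ f = f)
    (hmul : TermMul adjC locX locY Yfix (mayerTerm Op V φ))
    {nbr : Cube → Finset Cube} (hnbr : ∀ a b, adjC a b → a ∈ nbr b) {ν : ℝ} (hν : ∀ b, ((nbr b).card : ℝ) ≤ ν)
    {d : Finset Cube → ℝ} {c₁ R κ₀ K₀ cv τ : ℝ} (hd : ∀ X, 0 ≤ d X) (hc₁ : 0 ≤ c₁) (hK₀ : 0 ≤ K₀) (hτ : 0 ≤ τ)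
    (h197 : ∀ X, ‖F191 adjC locX locY Yfix (mayerTerm Op V φ) X‖ ≤ c₁ * Real.exp (-(R * d X)))
    (h126 : Ineq126 (polys190 adjC locX locY Yfix) (fun X => X \ Yfix) d κ₀ K₀)
    (hvol : VolBound (polys190 adjC locX locY Yfix) (fun X => X \ Yfix) d cv)
    (hrate : κ₀ + τ * cv ≤ R) (hsmall : c₁ * Real.exp (τ * cv) * K₀ * ν ≤ τ)
    (hreal : ∀ S D, (mayerTerm Op V φ S D).im = 0) :
    (bracket Op V φ).im = 0 ∧ 0 < (bracket Op V φ).re := by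
  rw [bracket_eq_sum_mayerTerm]
  exact re_sum_term_pos hrefl hsymm houtX houtY (by simp [mayerTerm, hOp0]) hmul hnbr hν hd hc₁ hK₀ hτ h197 h126 hvol
    hrate hsmall hreal

/-- **A REAL LOGARITHM OF THE CURLY BRACKET AT A REAL CONFIGURATION**: `{⋯} = e^{ρ}` with `ρ = Re Σ_X 𝐑′^{(k)}(X)` real and
`|ρ| ≤ c₁e^{τc_v}K₀ · #outside cubes`. [cite: Balaban1989LargeFieldII, (1.98) p.390] -/
theorem exists_log_bracket [Fintype LF] [Fintype DomY] [Fintype Cube] [DecidableEq LF] [DecidableEq DomY]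
    [DecidableRel adjC] (hrefl : ∀ a, adjC a a) (hsymm : ∀ a b, adjC a b → adjC b a)
    (houtX : ∀ j, (locX j \ Yfix).Nonempty) (houtY : ∀ Y, (locY Y \ Yfix).Nonempty)
    (Op : Finset LF → (Φ → ℂ) →+ (Φ → ℂ)) (V : DomY → Φ → ℂ) (φ : Φ) (hOp0 : ∀ f, Op ∅ f = f)
    (hmul : TermMul adjC locX locY Yfix (mayerTerm Op V φ))
    {nbr : Cube → Finset Cube} (hnbr : ∀ a b, adjC a b → a ∈ nbr b) {ν : ℝ} (hν : ∀ b, ((nbr b).card : ℝ) ≤ ν)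
    {d : Finset Cube → ℝ} {c₁ R κ₀ K₀ cv τ : ℝ} (hd : ∀ X, 0 ≤ d X) (hc₁ : 0 ≤ c₁) (hK₀ : 0 ≤ K₀) (hτ : 0 ≤ τ)
    (h197 : ∀ X, ‖F191 adjC locX locY Yfix (mayerTerm Op V φ) X‖ ≤ c₁ * Real.exp (-(R * d X)))
    (h126 : Ineq126 (polys190 adjC locX locY Yfix) (fun X => X \ Yfix) d κ₀ K₀)
    (hvol : VolBound (polys190 adjC locX locY Yfix) (fun X => X \ Yfix) d cv)
    (hrate : κ₀ + τ * cv ≤ R) (hsmall : c₁ * Real.exp (τ * cv) * K₀ * ν ≤ τ)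
    (hreal : ∀ S D, (mayerTerm Op V φ S D).im = 0) :
    ∃ ρ : ℝ, |ρ| ≤ (((polys190 adjC locX locY Yfix).biUnion fun X => X \ Yfix).card : ℝ) * (c₁ * Real.exp (τ * cv) * K₀) ∧
      bracket Op V φ = ((Real.exp ρ : ℝ) : ℂ) := by
  rw [bracket_eq_sum_mayerTerm]
  exact exists_log_sum_term hrefl hsymm houtX houtY (by simp [mayerTerm, hOp0]) hmul hnbr hν hd hc₁ hK₀ hτ h197 h126
    hvol hrate hsmall hreal

variable {Var Sv : Type*} {site : Var → Cube}

/-- **The modulus bound from the LOCALITY of the operations**: as `norm_bracket_le_exp`, with the factorization clause replaced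
by `LocalOps` and the localization `DepOn` of the `V(Y)` (the hypotheses of `bracket_eq_exp_sum_locR_of_localOps` VERBATIM).
[cite: Balaban1989LargeFieldII, (1.98) p.390] -/
theorem norm_bracket_le_exp_of_localOps [Fintype LF] [Fintype DomY] [Fintype Cube] [DecidableEq LF] [DecidableEq DomY]
    [DecidableRel adjC] (hrefl : ∀ a, adjC a a) (hsymm : ∀ a b, adjC a b → adjC b a)
    (houtX : ∀ j, (locX j \ Yfix).Nonempty) (houtY : ∀ Y, (locY Y \ Yfix).Nonempty)
    {Op : Finset LF → ((Var → Sv) → ℂ) →+ ((Var → Sv) → ℂ)} (hOps : LocalOps adjC locX Yfix site Op)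
    {V : DomY → (Var → Sv) → ℂ} (hV : ∀ Y, DepOn Yfix site (V Y) (locY Y)) (φ : Var → Sv)
    {nbr : Cube → Finset Cube} (hnbr : ∀ a b, adjC a b → a ∈ nbr b) {ν : ℝ} (hν : ∀ b, ((nbr b).card : ℝ) ≤ ν)
    {d : Finset Cube → ℝ} {c₁ R κ₀ K₀ cv τ : ℝ} (hd : ∀ X, 0 ≤ d X) (hc₁ : 0 ≤ c₁) (hK₀ : 0 ≤ K₀) (hτ : 0 ≤ τ)
    (h197 : ∀ X, ‖F191 adjC locX locY Yfix (mayerTerm Op V φ) X‖ ≤ c₁ * Real.exp (-(R * d X)))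
    (h126 : Ineq126 (polys190 adjC locX locY Yfix) (fun X => X \ Yfix) d κ₀ K₀)
    (hvol : VolBound (polys190 adjC locX locY Yfix) (fun X => X \ Yfix) d cv)
    (hrate : κ₀ + τ * cv ≤ R) (hsmall : c₁ * Real.exp (τ * cv) * K₀ * ν ≤ τ) :
    ‖bracket Op V φ‖ ≤ Real.exp ((((polys190 adjC locX locY Yfix).biUnion fun X => X \ Yfix).card : ℝ) * (c₁ * Real.exp (τ * cv) * K₀)) :=
  norm_bracket_le_exp hrefl hsymm houtX houtY Op V φ hOps.empty (termMul_mayerTerm hsymm hOps hV φ) hnbr hν hd hc₁ hK₀ hτ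
    h197 h126 hvol hrate hsmall

/-- **Positivity and the real logarithm from the LOCALITY of the operations** and reality of the data: as `re_bracket_pos` ∕
`exists_log_bracket` with `LocalOps`, `DepOn`, real `V(Y)` and reality-preserving operations. [cite: Balaban1989LargeFieldII, (1.98) p.390] -/
theorem exists_log_bracket_of_localOps [Fintype LF] [Fintype DomY] [Fintype Cube] [DecidableEq LF] [DecidableEq DomY]
    [DecidableRel adjC] (hrefl : ∀ a, adjC a a) (hsymm : ∀ a b, adjC a b → adjC b a)
    (houtX : ∀ j, (locX j \ Yfix).Nonempty) (houtY : ∀ Y, (locY Y \ Yfix).Nonempty)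
    {Op : Finset LF → ((Var → Sv) → ℂ) →+ ((Var → Sv) → ℂ)} (hOps : LocalOps adjC locX Yfix site Op)
    (hOpReal : ∀ (S : Finset LF) (f : (Var → Sv) → ℂ), (∀ ψ, (f ψ).im = 0) → ∀ φ, (Op S f φ).im = 0)
    {V : DomY → (Var → Sv) → ℂ} (hV : ∀ Y, DepOn Yfix site (V Y) (locY Y)) (hVreal : ∀ Y ψ, (V Y ψ).im = 0)
    (φ : Var → Sv)
    {nbr : Cube → Finset Cube} (hnbr : ∀ a b, adjC a b → a ∈ nbr b) {ν : ℝ} (hν : ∀ b, ((nbr b).card : ℝ) ≤ ν)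
    {d : Finset Cube → ℝ} {c₁ R κ₀ K₀ cv τ : ℝ} (hd : ∀ X, 0 ≤ d X) (hc₁ : 0 ≤ c₁) (hK₀ : 0 ≤ K₀) (hτ : 0 ≤ τ)
    (h197 : ∀ X, ‖F191 adjC locX locY Yfix (mayerTerm Op V φ) X‖ ≤ c₁ * Real.exp (-(R * d X)))
    (h126 : Ineq126 (polys190 adjC locX locY Yfix) (fun X => X \ Yfix) d κ₀ K₀)
    (hvol : VolBound (polys190 adjC locX locY Yfix) (fun X => X \ Yfix) d cv)
    (hrate : κ₀ + τ * cv ≤ R) (hsmall : c₁ * Real.exp (τ * cv) * K₀ * ν ≤ τ) :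
    (bracket Op V φ).im = 0 ∧ 0 < (bracket Op V φ).re ∧
      ∃ ρ : ℝ, |ρ| ≤ (((polys190 adjC locX locY Yfix).biUnion fun X => X \ Yfix).card : ℝ) * (c₁ * Real.exp (τ * cv) * K₀) ∧
        bracket Op V φ = ((Real.exp ρ : ℝ) : ℂ) := by
  have hreal := mayerTerm_im_eq_zero Op hOpReal hVreal φ
  have hmul := termMul_mayerTerm hsymm hOps hV φ
  obtain ⟨him, hre⟩ := re_bracket_pos hrefl hsymm houtX houtY Op V φ hOps.empty hmul hnbr hν hd hc₁ hK₀ hτ h197 h126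
    hvol hrate hsmall hreal
  exact ⟨him, hre, exists_log_bracket hrefl hsymm houtX houtY Op V φ hOps.empty hmul hnbr hν hd hc₁ hK₀ hτ h197 h126
    hvol hrate hsmall hreal⟩

end Bracket

/-! ## §4 The shapes consumed by `B16Cor3Ops.Repr172.uvIneq_of_repr172` -/

section Shapes

/-- **THE `hcurly` SHAPE**: the real part `c` of a quantity with positive real part and modulus `≤ exp(b·#Q)`, with
the cube count `#Q ≤ πc·N` (`B16Cor3Torus.cubeCount_torus`-type tiling), satisfies `0 ≤ c ∧ c ≤ exp((πc·b)·N)` — the literal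
hypothesis `hcurly : ∀ a V, 0 ≤ R.curly a V ∧ R.curly a V ≤ Real.exp (ε′ * numSites)` of `uvIneq_of_repr172` at
`curly a V := ({⋯}_a V).re`, `ε′ = πc·b`. [cite: Balaban1988Convergent, (2.50) p.264] -/
theorem hcurly_shape {z : ℂ} {b Q πc N : ℝ} (hre : 0 < z.re) (hnorm : ‖z‖ ≤ Real.exp (Q * b))
    (hb : 0 ≤ b) (hQ : Q ≤ πc * N) : 0 ≤ z.re ∧ z.re ≤ Real.exp ((πc * b) * N) := by
  refine ⟨hre.le, ?_⟩
  have h1 : z.re ≤ ‖z‖ := Complex.re_le_norm z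
  have h2 : Real.exp (Q * b) ≤ Real.exp ((πc * b) * N) :=
    Real.exp_le_exp.2 (by nlinarith [mul_le_mul_of_nonneg_right hQ hb])
  exact h1.trans (hnorm.trans h2)

/-- **THE `h0c`∕`hR` SHAPE** (the all-small term of (1.72): `{⋯} = exp Rre`, `|Rre| ≤ ε·N`): from `z = e^{ρ}` with `|ρ| ≤ b·#Q`
and `#Q ≤ πc·N`, the real part is `exp ρ` with `|ρ| ≤ (πc·b)·N`. [cite: Balaban1988Convergent, (2.50) p.264] -/
theorem h0c_shape {z : ℂ} {ρ b Q πc N : ℝ} (hz : z = ((Real.exp ρ : ℝ) : ℂ)) (hρ : |ρ| ≤ Q * b) (hb : 0 ≤ b)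
    (hQ : Q ≤ πc * N) : z.re = Real.exp ρ ∧ |ρ| ≤ (πc * b) * N := by
  refine ⟨by rw [hz, Complex.ofReal_re], hρ.trans ?_⟩
  nlinarith [mul_le_mul_of_nonneg_right hQ hb]

end Shapes

end Literature.MathematicalPhysics.QuantumFieldTheory.Balaban1983to89.B16CurlyBracketVolume

end
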